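import Literature.Probability.RandomMatrix.TwoQubitBlochShellVolumes
import Literature.Probability.RandomMatrix.TwoQubitSeparabilityVolumesProofs
import Literature.Probability.RandomMatrix.TwoQubitSeparabilityVolumesBlochFibreProofs
import Literature.Probability.RandomMatrix.TwoQubitLambdaMaxFibreRadial
import HarnessLib

/-!
# Bloch-shell volumes of two-qubit states: reduction to the fibre ratio
# (Zhang–Jiang–Xie 2025, §6.1–6.2: Props. 6.5, 6.6, 6.7 ⟹ the shell form of Prop. 6.10)

Proofs companion of `TwoQubitBlochShellVolumes.lean` (the statements file of the named fact
`ZhangJiangXie2025_blochShell_volume_ratio`; theorems only here: no definitions, no new named facts).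

## What is proved (sorry-free)

`ZhangJiangXie2025_blochShell_volume_ratio_of_fibre_ratio :
  ZhangJiangXie2025_qubit_blochFibre_lambdaMax_ratio → ZhangJiangXie2025_blochShell_volume_ratio`,

i.e. the Bloch-SHELL identity `33·J(t)·vol₁₅(D ∩ D_ss ∩ {|r| ≤ t}) = I(t)·vol₁₅(D ∩ {|r| ≤ t})`
(`0 < t ≤ 1/3`) follows from the Bloch-FIBRE ratio
`33(1−a²)⁶·vol₁₂(D^a ∩ D_ss) = (1−a)⁹(33a³+162a²+72a+8)·vol₁₂(D^a)` (`a ∈ [0,1/3)`, the named fact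
`ZhangJiangXie2025_qubit_blochFibre_lambdaMax_ratio` of `TwoQubitSeparabilityVolumesBlochFibre.lean` =
[ZhangJiangXie2025, Prop. 6.10 with Prop. 6.7], whose only published proofs are the Duistermaat–Heckman
computation of the source and [HuongKhoi2024]) by "ordinary measure theory on the chart", exactly as
in the printed proofs of Prop. 6.6 and of Prop. 6.10 (first display):

1. **Prop. 6.6 (disintegration).** The entry chart `y ∈ ℝ¹⁵` is the measure-preserving image of
   `(x, d) ∈ ℝ¹² × ℝ³`, `x` the fibre coordinates and `d = (σ, Re z, Im z)` the coordinates of the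
   marginal `M = X + Y = [[σ, z], [z̄, 1 − σ]]` (`HuongKhoi2024.measurePreserving_fibreChart`, tree);
   on it `twoQubitMatrix y = Rmat σ z x` (`Rmat_eq_twoQubitMatrix`) and `blochNormSq y = (2σ−1)² + 4|z|²`;
   Tonelli gives `vol₁₅(body ∩ shell_t) = ∫_{|r(d)| ≤ t} vol₁₂(fibre body over d) dd`
   (`volume_shell_eq_lintegral`, `volume_shell_ss_eq_lintegral`).
2. **Prop. 6.5 (covariance).** Conjugation by `1 ⊗ U`, `U ∈ U(2)`, shows that both fibre volumes
   depend on the marginal only through its Bloch length `a = |r|` (two-sided body: tree,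
   `Ftilde_eq_Fvol`; one-sided body: `volume_posSemidef_Rmat_eq` here, same proof).
3. **Polar coordinates** (the `⅛·4πa²` of the printed proof of Prop. 6.6):
   `∫_{|r(d)| ≤ t} h(|r(d)|) dd = (π/2)∫₀ᵗ a² h(a) da` (`lintegral_blochBall_radial`: polar
   coordinates in `z`, the substitution `a = √((2σ−1)² + 4s)` and Tonelli in `(σ, a)`; the two
   one-dimensional tools are the tree's `lintegral_comp_normSq`, `lintegral_Ioi_sqrt_subst`).
4. **Values.** On `(0, t) ⊆ (0, 1/3)` the fibre volumes are `vol₁₂(D^a) = (1−a²)⁶·π⁵/1238630400`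
   (Prop. 6.7 in chart units, tree: `volume_blochFibre_posSemidef_value`) and, GIVEN the fibre fact,
   `vol₁₂(D^a ∩ D_ss) = π⁵(1−a)⁹(33a³+…+8)/40874803200` (tree: `blochFibre_lambdaMax_ratio_iff`); the
   two polynomial integrals are `J(t) = blochShellJ t`, `I(t) = blochShellI t` by the fundamental
   theorem of calculus (`hasDerivAt_blochShellJ`, `hasDerivAt_blochShellI`), and
   `33·J·(π/2)(π⁵/40874803200)·I = I·(π/2)(π⁵/1238630400)·J` since `40874803200 = 33·1238630400`.

Hence `ZhangJiangXie2025_blochShell_volume_ratio_holds` is ONE LINE once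
`ZhangJiangXie2025_qubit_blochFibre_lambdaMax_ratio_holds` lands (in flight elsewhere in this
directory: the `TwoQubitLambdaMax*` files); nothing printed in the source beyond Props. 6.5–6.7 is
used here, and no absolute Hilbert–Schmidt normalisation enters (all constants cancel in the ratio).

## References

* [ZhangJiangXie2025] L. Zhang, X. Jiang, B. Xie, *One application of Duistermaat–Heckman measure in
  quantum information theory*, Quantum Inf. Comput. 25 (2025) 598–632 = arXiv:2507.02369 (held,
  read pp. 14–18): §6.1 Prop. 6.5 (p. 14, `U(2) → SO(3)` covariance), Prop. 6.6 (p. 14,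
  `vol_HS(D) = ⅛∫_{B₁} vol_HS(D^r)[dr] = (π/2)∫₀¹ a² vol_HS(D^a) da`), Prop. 6.7 (p. 14), §6.2
  Prop. 6.10 and its proof's first display `(π/2)∫₀ᵗ a² f(a) da = vol_HS(D^{B_t} ∩ D_ss)` (p. 16),
  Remark 6.11 (p. 18).
* [LovasAndai2017] A. Lovas, A. Andai, J. Phys. A 50 (2017) 295303 (Prop. 6.7 = their Cor. 1–2).
* [HuongKhoi2024] H. T. Huong, V. T. Khoi, J. Phys. A 57 (2024) 445304 (Prop. 6.10).
-/

noncomputable section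

open _root_.MeasureTheory Set Real
open scoped ENNReal ComplexOrder Matrix ComplexConjugate
open Complex Matrix

namespace Literature.Probability.RandomMatrix

namespace ZhangJiangXie2025

namespace BlochShell

/-! ## 1. The one-sided fibre body: covariance under `1 ⊗ U` (Prop. 6.5) -/

/-- At `z = 0`, `σ = (1+a)/2` the one-sided body over the general marginal `M(σ, z)` is the
one-sided Bloch-fibre body: `vol₁₂ {x : Rmat ((1+a)/2) 0 x ≽ 0} = vol₁₂ {x : ρ_a(x) ≽ 0}`. [folklore] -/
theorem volume_posSemidef_Rmat_bloch (a : ℝ) :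
    volume {x : Fin 12 → ℝ | (Rmat ((1 + a) / 2) 0 x).PosSemidef} =
      volume {x : Fin 12 → ℝ | (qubitBlochFibreMatrix a x).PosSemidef} := by
  simp only [Rmat_bloch]

/-- **Invariance of the one-sided body under `1 ⊗ U`** (the mechanism of Prop. 6.5).
[cite: ZhangJiangXie2025, Prop 6.5 (proof)] -/
theorem mem_oneSided_TB_iff {U : Matrix (Fin 2) (Fin 2) ℂ} (hU : U ∈ Matrix.unitaryGroup (Fin 2) ℂ)
    {σ σ' : ℝ} {z z' : ℂ} (hM : U * Mm σ z * star U = Mm σ' z') (x : Fin 12 → ℝ) :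
    (Rmat σ' z' (TB U x)).PosSemidef ↔ (Rmat σ z x).PosSemidef := by
  have hU' : U * star U = 1 := Matrix.mem_unitaryGroup_iff.mp hU
  rw [Rmat_TB hM, reindex_apply, posSemidef_submatrix_equiv, posSemidef_fromBlocks_conj_iff hU',
    Rmat, reindex_apply, posSemidef_submatrix_equiv]

/-- **Covariance**: if `U M(σ,z) U* = M(σ',z')` for a unitary `U` then the one-sided fibre volumes
over `M(σ,z)` and `M(σ',z')` agree. [cite: ZhangJiangXie2025, Prop 6.5] -/
theorem volume_posSemidef_Rmat_eq_of_conj {U : Matrix (Fin 2) (Fin 2) ℂ}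
    (hU : U ∈ Matrix.unitaryGroup (Fin 2) ℂ) {σ σ' : ℝ} {z z' : ℂ}
    (hM : U * Mm σ z * star U = Mm σ' z') :
    volume {x : Fin 12 → ℝ | (Rmat σ z x).PosSemidef} =
      volume {x : Fin 12 → ℝ | (Rmat σ' z' x).PosSemidef} := by
  have hset : {x : Fin 12 → ℝ | (Rmat σ z x).PosSemidef} =
      TB U ⁻¹' {x : Fin 12 → ℝ | (Rmat σ' z' x).PosSemidef} := by
    ext x
    simp only [mem_setOf_eq, mem_preimage]
    exact (mem_oneSided_TB_iff hU hM x).symm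
  rw [hset, volume_preimage_TB hU]

/-- **The one-sided fibre volume is even in the Bloch length** (the swap unitary):
`vol₁₂ {x : ρ_{−a}(x) ≽ 0} = vol₁₂ {x : ρ_a(x) ≽ 0}`. [folklore] -/
theorem volume_posSemidef_blochFibre_neg (a : ℝ) :
    volume {x : Fin 12 → ℝ | (qubitBlochFibreMatrix (-a) x).PosSemidef} =
      volume {x : Fin 12 → ℝ | (qubitBlochFibreMatrix a x).PosSemidef} := by
  rw [← volume_posSemidef_Rmat_bloch (-a), ← volume_posSemidef_Rmat_bloch a]
  exact (volume_posSemidef_Rmat_eq_of_conj swapU_mem (swapU_conj_Mm a)).symm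

/-- **The one-sided fibre volume depends only on the Bloch length** (Prop. 6.5 for the body
`D = {ρ ≽ 0}`): `vol₁₂ {x : Rmat σ z x ≽ 0} = vol₁₂ {x : ρ_r(x) ≽ 0}`, `r = √((2σ−1)² + 4|z|²)`.
[cite: ZhangJiangXie2025, Prop 6.5] -/
theorem volume_posSemidef_Rmat_eq (σ : ℝ) (z : ℂ) :
    volume {x : Fin 12 → ℝ | (Rmat σ z x).PosSemidef} =
      volume {x : Fin 12 → ℝ | (qubitBlochFibreMatrix (blochLen σ z) x).PosSemidef} := by
  obtain ⟨U, hU, μ, hM, hμ⟩ := exists_conj_Mm_diag σ z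
  rw [volume_posSemidef_Rmat_eq_of_conj hU hM]
  have : μ = (1 + (2 * μ - 1)) / 2 := by ring
  rw [this, volume_posSemidef_Rmat_bloch]
  rcases (sq_eq_sq_iff_eq_or_eq_neg).mp hμ with h2 | h2
  · rw [h2]
  · rw [h2, volume_posSemidef_blochFibre_neg]

/-! ## 2. Measurability of the one-sided fibre volume; the two-sided value given the fibre fact
(Prop. 6.10; the one-sided value, Prop. 6.7, is the tree's `volume_blochFibre_posSemidef_value`) -/

/-- The graph set `{(a, x) : ρ_a(x) ≽ 0}` is closed. [folklore] -/
theorem isClosed_blochGraph_oneSided :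
    IsClosed {p : ℝ × (Fin 12 → ℝ) | (qubitBlochFibreMatrix p.1 p.2).PosSemidef} := by
  have hc : Continuous fun p : ℝ × (Fin 12 → ℝ) => qubitBlochFibreMatrix p.1 p.2 := by
    refine continuous_matrix fun i j => ?_
    fin_cases i <;> fin_cases j <;> simp [qubitBlochFibreMatrix] <;> first
      | fun_prop
      | (apply continuous_cmk <;> fun_prop)
  exact isClosed_posSemidef.preimage hc

/-- The one-sided fibre volume `a ↦ vol₁₂ {x : ρ_a(x) ≽ 0}` is measurable. [folklore] -/
theorem measurable_volume_posSemidef_blochFibre :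
    Measurable fun a : ℝ => volume {x : Fin 12 → ℝ | (qubitBlochFibreMatrix a x).PosSemidef} :=
  measurable_measure_prodMk_left (ν := (volume : Measure (Fin 12 → ℝ)))
    isClosed_blochGraph_oneSided.measurableSet

/-- **Prop. 6.10 in chart units, from the fibre fact**:
`F(a) = π⁵(1−a)⁹(33a³+162a²+72a+8)/40874803200` for `a ∈ [0, 1/3)` (tree:
`blochFibre_lambdaMax_ratio_iff`). [cite: ZhangJiangXie2025, Prop 6.10 (p. 16)] -/
theorem Fvol_eq (hX : ZhangJiangXie2025_qubit_blochFibre_lambdaMax_ratio) {a : ℝ} (ha₀ : 0 ≤ a)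
    (ha₃ : a < 1 / 3) :
    Fvol a = ENNReal.ofReal
      (π ^ 5 * ((1 - a) ^ 9 * (33 * a ^ 3 + 162 * a ^ 2 + 72 * a + 8)) / 40874803200) :=
  (blochFibre_lambdaMax_ratio_iff.mp hX) a ha₀ ha₃

/-! ## 3. The two polynomial integrals `J` and `I` (fundamental theorem of calculus) -/

/-- `J'(s) = s²(1 − s²)⁶`. [folklore] -/
theorem hasDerivAt_blochShellJ (s : ℝ) :
    HasDerivAt blochShellJ (s ^ 2 * (1 - s ^ 2) ^ 6) s := by
  have h := (((((((hasDerivAt_pow 3 s).div_const 3).fun_sub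
    (((hasDerivAt_pow 5 s).const_mul 6).div_const 5)).fun_add
    (((hasDerivAt_pow 7 s).const_mul 15).div_const 7)).fun_sub
    (((hasDerivAt_pow 9 s).const_mul 20).div_const 9)).fun_add
    (((hasDerivAt_pow 11 s).const_mul 15).div_const 11)).fun_sub
    (((hasDerivAt_pow 13 s).const_mul 6).div_const 13)).fun_add
    ((hasDerivAt_pow 15 s).div_const 15)
  have e : blochShellJ = fun x : ℝ => x ^ 3 / 3 - 6 * x ^ 5 / 5 + 15 * x ^ 7 / 7 - 20 * x ^ 9 / 9 +
      15 * x ^ 11 / 11 - 6 * x ^ 13 / 13 + x ^ 15 / 15 := by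
    funext x; rfl
  rw [e]
  refine h.congr_deriv ?_
  norm_num
  ring

/-- `I'(s) = s²(1 − s)⁹(33s³ + 162s² + 72s + 8)`. [folklore] -/
theorem hasDerivAt_blochShellI (s : ℝ) :
    HasDerivAt blochShellI (s ^ 2 * (1 - s) ^ 9 * (33 * s ^ 3 + 162 * s ^ 2 + 72 * s + 8)) s := by
  have h := ((((((((((((hasDerivAt_pow 3 s).const_mul (8 / 3)).fun_sub
    ((hasDerivAt_pow 5 s).const_mul (198 / 5))).fun_add
    ((hasDerivAt_pow 6 s).const_mul (165 / 2))).fun_add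
    ((hasDerivAt_pow 7 s).const_mul (495 / 7))).fun_sub
    ((hasDerivAt_pow 8 s).const_mul (1089 / 2))).fun_add
    ((hasDerivAt_pow 9 s).const_mul (3080 / 3))).fun_sub
    ((hasDerivAt_pow 10 s).const_mul (5247 / 5))).fun_add
    ((hasDerivAt_pow 11 s).const_mul 630)).fun_sub
    ((hasDerivAt_pow 12 s).const_mul (605 / 3))).fun_add
    ((hasDerivAt_pow 13 s).const_mul (198 / 13))).fun_add
    ((hasDerivAt_pow 14 s).const_mul (135 / 14))).fun_sub
    ((hasDerivAt_pow 15 s).const_mul (11 / 5))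
  have e : blochShellI = fun x : ℝ => 8 / 3 * x ^ 3 - 198 / 5 * x ^ 5 + 165 / 2 * x ^ 6 +
      495 / 7 * x ^ 7 - 1089 / 2 * x ^ 8 + 3080 / 3 * x ^ 9 - 5247 / 5 * x ^ 10 + 630 * x ^ 11 -
      605 / 3 * x ^ 12 + 198 / 13 * x ^ 13 + 135 / 14 * x ^ 14 - 11 / 5 * x ^ 15 := by
    funext x; rfl
  rw [e]
  refine h.congr_deriv ?_
  norm_num
  ring

/-- `∫₀ᵗ a²(1 − a²)⁶ da = J(t)`. [folklore] -/
theorem integral_blochShellJ (t : ℝ) :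
    ∫ a in (0 : ℝ)..t, a ^ 2 * (1 - a ^ 2) ^ 6 = blochShellJ t := by
  rw [intervalIntegral.integral_eq_sub_of_hasDerivAt (fun a _ => hasDerivAt_blochShellJ a)
    (by apply Continuous.intervalIntegrable; fun_prop), blochShellJ_zero, sub_zero]

/-- `∫₀ᵗ a²(1 − a)⁹(33a³ + 162a² + 72a + 8) da = I(t)`. [folklore] -/
theorem integral_blochShellI (t : ℝ) :
    ∫ a in (0 : ℝ)..t, a ^ 2 * (1 - a) ^ 9 * (33 * a ^ 3 + 162 * a ^ 2 + 72 * a + 8) =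
      blochShellI t := by
  rw [intervalIntegral.integral_eq_sub_of_hasDerivAt (fun a _ => hasDerivAt_blochShellI a)
    (by apply Continuous.intervalIntegrable; fun_prop), blochShellI_zero, sub_zero]

/-! ## 4. Polar coordinates on the Bloch ball (the `⅛ · 4πa²` of the proof of Prop. 6.6) -/

/-- The marginal coordinates `d ↦ (σ, z) = (d 0, d 1 + d 2 i) ∈ ℝ × ℂ` preserve Lebesgue measure.
[folklore] -/
theorem measurePreserving_blochCoords :
    MeasurePreserving (fun d : Fin 3 → ℝ => (d 0, (⟨d 1, d 2⟩ : ℂ))) volume volume := by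
  have h1 := volume_preserving_piFinSuccAbove (fun _ : Fin 3 => ℝ) 0
  have h23 : MeasurePreserving (fun v : Fin 2 → ℝ => (⟨v 0, v 1⟩ : ℂ)) volume volume := by
    have h := Complex.volume_preserving_equiv_real_prod.symm.comp (volume_preserving_finTwoArrow ℝ)
    have e : (fun v : Fin 2 → ℝ => (⟨v 0, v 1⟩ : ℂ)) =
        Complex.measurableEquivRealProd.symm ∘
          (MeasurableEquiv.finTwoArrow : (Fin 2 → ℝ) ≃ᵐ ℝ × ℝ) := by
      funext v; rfl
    rw [e]; exact h
  have h := ((MeasurePreserving.id (volume : Measure ℝ)).prod h23).comp h1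
  have e : (fun d : Fin 3 → ℝ => (d 0, (⟨d 1, d 2⟩ : ℂ))) =
      Prod.map id (fun v : Fin 2 → ℝ => (⟨v 0, v 1⟩ : ℂ)) ∘
        (MeasurableEquiv.piFinSuccAbove (fun _ : Fin 3 => ℝ) 0) := by
    funext d; rfl
  rw [e]; exact h

/-- The slab `{σ : |2σ − 1| < a}` has length `a` (`ofReal a`, i.e. `0`, when `a ≤ 0`). [folklore] -/
theorem volume_slab (a : ℝ) : volume {σ : ℝ | |2 * σ - 1| < a} = ENNReal.ofReal a := by
  rcases le_or_gt a 0 with ha | ha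
  · have : {σ : ℝ | |2 * σ - 1| < a} = ∅ := by
      ext σ
      simp only [mem_setOf_eq, mem_empty_iff_false, iff_false, not_lt]
      exact ha.trans (abs_nonneg _)
    rw [this, measure_empty, ENNReal.ofReal_of_nonpos ha]
  · have : {σ : ℝ | |2 * σ - 1| < a} = Ioo ((1 - a) / 2) ((1 + a) / 2) := by
      ext σ
      simp only [mem_setOf_eq, mem_Ioo, abs_lt]
      constructor <;> intro h <;> constructor <;> linarith [h.1, h.2]
    rw [this, Real.volume_Ioo]
    congr 1
    ring

/-- **Polar coordinates on the Bloch ball** (the computation `⅛∫_{S_a}[dr] = ⅛·4πa²` in the proof of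
Prop. 6.6): for measurable `h ≥ 0` and `t > 0`,
`∫_{(2d₀−1)² + 4d₁² + 4d₂² ≤ t²} h(|r(d)|) dd = (π/2) ∫_{(0,t)} a² h(a) da`, `|r(d)|` the Bloch length
of the marginal `M(d₀, d₁ + d₂ i)`. Proof: polar coordinates in `z = d₁ + d₂ i`, the substitution
`a = √((2σ−1)² + 4|z|²)` and Tonelli in `(σ, a)` (the slab `|2σ − 1| < a` has length `a`).
[cite: ZhangJiangXie2025, Prop 6.6 (proof)] -/
theorem lintegral_blochBall_radial {h : ℝ → ℝ≥0∞} (hh : Measurable h) {t : ℝ} (ht : 0 < t) :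
    ∫⁻ d in {d : Fin 3 → ℝ | (2 * d 0 - 1) ^ 2 + 4 * d 1 ^ 2 + 4 * d 2 ^ 2 ≤ t ^ 2},
        h (blochLen (d 0) ⟨d 1, d 2⟩) =
      ENNReal.ofReal (π / 2) * ∫⁻ a in Ioo 0 t, ENNReal.ofReal (a ^ 2) * h a := by
  have hnormSq : Continuous (normSq : ℂ → ℝ) := Complex.continuous_normSq
  -- (a) transport to `ℝ × ℂ`
  set B' : Set (ℝ × ℂ) := {q | (2 * q.1 - 1) ^ 2 + 4 * normSq q.2 ≤ t ^ 2} with hB'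
  have hB'meas : MeasurableSet B' :=
    (isClosed_le ((((continuous_const.mul continuous_fst).sub continuous_const).pow 2).add
      (continuous_const.mul (hnormSq.comp continuous_snd))) continuous_const).measurableSet
  have hbl : Measurable fun q : ℝ × ℂ => blochLen q.1 q.2 := by
    unfold blochLen
    exact ((((measurable_const.mul measurable_fst).sub measurable_const).pow_const 2).add
      (measurable_const.mul (hnormSq.measurable.comp measurable_snd))).sqrt
  have hF : Measurable fun q : ℝ × ℂ => h (blochLen q.1 q.2) := hh.comp hbl
  have hpre : {d : Fin 3 → ℝ | (2 * d 0 - 1) ^ 2 + 4 * d 1 ^ 2 + 4 * d 2 ^ 2 ≤ t ^ 2} =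
      (fun d : Fin 3 → ℝ => (d 0, (⟨d 1, d 2⟩ : ℂ))) ⁻¹' B' := by
    ext d
    have e : (2 * d 0 - 1) ^ 2 + 4 * normSq (⟨d 1, d 2⟩ : ℂ) =
        (2 * d 0 - 1) ^ 2 + 4 * d 1 ^ 2 + 4 * d 2 ^ 2 := by
      rw [normSq_mk]; ring
    simp only [mem_setOf_eq, mem_preimage, hB', e]
  rw [hpre]
  refine (measurePreserving_blochCoords.setLIntegral_comp_preimage hB'meas hF).trans ?_
  -- (b) Tonelli on `ℝ × ℂ`; the inner integral in `z` by polar coordinates and the substitution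
  rw [← lintegral_indicator hB'meas, Measure.volume_eq_prod,
    lintegral_prod _ (hF.indicator hB'meas).aemeasurable]
  set K : ℝ → ℝ≥0∞ := (Iic t).indicator h with hK
  have hKmeas : Measurable K := hh.indicator measurableSet_Iic
  have hinner : ∀ σ : ℝ, ∫⁻ z, B'.indicator (fun q : ℝ × ℂ => h (blochLen q.1 q.2)) (σ, z) =
      ENNReal.ofReal π * ∫⁻ a in Ioi |2 * σ - 1|, ENNReal.ofReal (a / 2) * K a := by
    intro σ
    have hx : 0 ≤ |2 * σ - 1| := abs_nonneg _
    have hpt : ∀ z : ℂ, B'.indicator (fun q : ℝ × ℂ => h (blochLen q.1 q.2)) (σ, z) =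
        K (blochLen σ z) := by
      intro z
      by_cases hz : (2 * σ - 1) ^ 2 + 4 * normSq z ≤ t ^ 2
      · have hle : blochLen σ z ≤ t := by
          unfold blochLen
          calc Real.sqrt ((2 * σ - 1) ^ 2 + 4 * normSq z)
              ≤ Real.sqrt (t ^ 2) := Real.sqrt_le_sqrt hz
            _ = t := Real.sqrt_sq ht.le
        rw [indicator_of_mem (show (σ, z) ∈ B' from hz), hK,
          indicator_of_mem (show blochLen σ z ∈ Iic t from hle)]
      · have hlt : t < blochLen σ z := by
          unfold blochLen
          calc t = Real.sqrt (t ^ 2) := (Real.sqrt_sq ht.le).symm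
            _ < Real.sqrt ((2 * σ - 1) ^ 2 + 4 * normSq z) :=
              Real.sqrt_lt_sqrt (sq_nonneg _) (not_le.mp hz)
        rw [indicator_of_notMem (show (σ, z) ∉ B' from hz), hK,
          indicator_of_notMem (show blochLen σ z ∉ Iic t from not_le.mpr hlt)]
    simp_rw [hpt]
    rw [show (fun z : ℂ => K (blochLen σ z)) =
        fun z : ℂ => (fun s : ℝ => K (Real.sqrt (|2 * σ - 1| ^ 2 + 4 * s))) (normSq z) from
      funext fun z => by simp only [blochLen, sq_abs]]
    rw [lintegral_comp_normSq (fun s : ℝ => K (Real.sqrt (|2 * σ - 1| ^ 2 + 4 * s)))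
      (hKmeas.comp (by fun_prop)), lintegral_Ioi_sqrt_subst hx K]
  simp_rw [hinner]
  rw [lintegral_const_mul' _ _ ENNReal.ofReal_ne_top]
  -- (c) Tonelli in `(σ, a)`: the slab `|2σ − 1| < a` has length `a`
  set W : ℝ → ℝ → ℝ≥0∞ := fun σ a =>
    {p : ℝ × ℝ | |2 * p.1 - 1| < p.2}.indicator (fun p => ENNReal.ofReal (p.2 / 2) * K p.2) (σ, a)
    with hW
  have hWmeas : Measurable (Function.uncurry W) := by
    refine Measurable.indicator ?_ (measurableSet_lt (by fun_prop) measurable_snd)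
    exact (measurable_snd.div_const 2).ennreal_ofReal.mul (hKmeas.comp measurable_snd)
  have hW1 : ∀ σ : ℝ, ∫⁻ a in Ioi |2 * σ - 1|, ENNReal.ofReal (a / 2) * K a = ∫⁻ a, W σ a := by
    intro σ
    rw [← lintegral_indicator measurableSet_Ioi]
    rfl
  simp_rw [hW1]
  rw [lintegral_lintegral_swap hWmeas.aemeasurable]
  have hW2 : ∀ a : ℝ, ∫⁻ σ, W σ a = ENNReal.ofReal (a / 2) * K a * ENNReal.ofReal a := by
    intro a
    have : (fun σ => W σ a) =
        {σ : ℝ | |2 * σ - 1| < a}.indicator (fun _ => ENNReal.ofReal (a / 2) * K a) := by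
      funext σ
      simp only [hW, indicator_apply, mem_setOf_eq]
    rw [this, lintegral_indicator_const (measurableSet_lt (by fun_prop) measurable_const),
      volume_slab]
  simp_rw [hW2]
  -- (d) the integrand lives on `(0, t]`
  have hW3 : (fun a => ENNReal.ofReal (a / 2) * K a * ENNReal.ofReal a) =
      (Ioc 0 t).indicator (fun a => ENNReal.ofReal (1 / 2) * (ENNReal.ofReal (a ^ 2) * h a)) := by
    funext a
    by_cases ha : a ∈ Ioc 0 t
    · rw [indicator_of_mem ha, hK, indicator_of_mem (mem_Iic.mpr ha.2),
        show a / 2 = 1 / 2 * a by ring, ENNReal.ofReal_mul (by norm_num : (0 : ℝ) ≤ 1 / 2), sq,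
        ENNReal.ofReal_mul ha.1.le]
      ring
    · rw [indicator_of_notMem ha]
      rcases le_or_gt a 0 with ha0 | ha0
      · rw [ENNReal.ofReal_of_nonpos ha0, mul_zero]
      · have hta : t < a := by
          simp only [mem_Ioc, not_and, not_le] at ha
          exact ha ha0
        rw [hK, indicator_of_notMem (show a ∉ Iic t from not_le.mpr hta), mul_zero, zero_mul]
  rw [hW3, lintegral_indicator measurableSet_Ioc, setLIntegral_congr Ioo_ae_eq_Ioc.symm,
    lintegral_const_mul' _ _ ENNReal.ofReal_ne_top, ← mul_assoc, ← ENNReal.ofReal_mul pi_pos.le,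
    show π * (1 / 2) = π / 2 by ring]

/-! ## 5. The two one-dimensional integrals -/

/-- `∫_{(0,t)} a² vol₁₂(D^a) da = (π⁵/1238630400)·J(t)` for `0 < t < 1` (Prop. 6.7 in chart units,
tree: `volume_blochFibre_posSemidef_value`, integrated against `a² da`).
[cite: ZhangJiangXie2025, Prop 6.7 (p. 14) and its proof (second display)] -/
theorem lintegral_sq_mul_volume_posSemidef {t : ℝ} (ht0 : 0 < t) (ht1 : t < 1) :
    ∫⁻ a in Ioo 0 t, ENNReal.ofReal (a ^ 2) *
        volume {x : Fin 12 → ℝ | (qubitBlochFibreMatrix a x).PosSemidef} =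
      ENNReal.ofReal (π ^ 5 / 1238630400 * blochShellJ t) := by
  have hval : ∀ a ∈ Ioo 0 t, ENNReal.ofReal (a ^ 2) *
      volume {x : Fin 12 → ℝ | (qubitBlochFibreMatrix a x).PosSemidef} =
      ENNReal.ofReal (a ^ 2 * ((1 - a ^ 2) ^ 6 * (π ^ 5 / 1238630400))) := by
    intro a ha
    rw [volume_blochFibre_posSemidef_value (by linarith [ha.1]) (by linarith [ha.2]),
      ← ENNReal.ofReal_mul (sq_nonneg a)]
  rw [setLIntegral_congr_fun measurableSet_Ioo hval, ← ofReal_integral_eq_lintegral_ofReal]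
  · congr 1
    rw [← integral_Ioc_eq_integral_Ioo, ← intervalIntegral.integral_of_le ht0.le]
    calc ∫ a in (0 : ℝ)..t, a ^ 2 * ((1 - a ^ 2) ^ 6 * (π ^ 5 / 1238630400))
        = π ^ 5 / 1238630400 * ∫ a in (0 : ℝ)..t, a ^ 2 * (1 - a ^ 2) ^ 6 := by
          rw [← intervalIntegral.integral_const_mul]
          congr 1
          funext a
          ring
      _ = π ^ 5 / 1238630400 * blochShellJ t := by rw [integral_blochShellJ]
  · exact (Continuous.integrableOn_Icc (by fun_prop)).mono_set Ioo_subset_Icc_self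
  · exact ae_of_all _ fun a => by positivity

/-- `∫_{(0,t)} a² F(a) da = (π⁵/40874803200)·I(t)` for `0 < t ≤ 1/3`, GIVEN the fibre fact
(Prop. 6.10 integrated: the first display of its proof).
[cite: ZhangJiangXie2025, Prop 6.10 (proof, first display)] -/
theorem lintegral_sq_mul_Fvol (hX : ZhangJiangXie2025_qubit_blochFibre_lambdaMax_ratio) {t : ℝ}
    (ht0 : 0 < t) (ht1 : t ≤ 1 / 3) :
    ∫⁻ a in Ioo 0 t, ENNReal.ofReal (a ^ 2) * Fvol a =
      ENNReal.ofReal (π ^ 5 / 40874803200 * blochShellI t) := by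
  have hval : ∀ a ∈ Ioo 0 t, ENNReal.ofReal (a ^ 2) * Fvol a =
      ENNReal.ofReal (a ^ 2 * (π ^ 5 * ((1 - a) ^ 9 * (33 * a ^ 3 + 162 * a ^ 2 + 72 * a + 8)) /
        40874803200)) := by
    intro a ha
    rw [Fvol_eq hX ha.1.le (by linarith [ha.2]), ← ENNReal.ofReal_mul (sq_nonneg a)]
  rw [setLIntegral_congr_fun measurableSet_Ioo hval, ← ofReal_integral_eq_lintegral_ofReal]
  · congr 1
    rw [← integral_Ioc_eq_integral_Ioo, ← intervalIntegral.integral_of_le ht0.le]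
    calc ∫ a in (0 : ℝ)..t,
          a ^ 2 * (π ^ 5 * ((1 - a) ^ 9 * (33 * a ^ 3 + 162 * a ^ 2 + 72 * a + 8)) / 40874803200)
        = π ^ 5 / 40874803200 *
            ∫ a in (0 : ℝ)..t, a ^ 2 * (1 - a) ^ 9 * (33 * a ^ 3 + 162 * a ^ 2 + 72 * a + 8) := by
          rw [← intervalIntegral.integral_const_mul]
          congr 1
          funext a
          ring
      _ = π ^ 5 / 40874803200 * blochShellI t := by rw [integral_blochShellI]
  · exact (Continuous.integrableOn_Icc (by fun_prop)).mono_set Ioo_subset_Icc_self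
  · refine (ae_restrict_iff' measurableSet_Ioo).mpr (ae_of_all _ fun a ha => ?_)
    have h1 : 0 ≤ 1 - a := by linarith [ha.2]
    have h0 : 0 ≤ a := ha.1.le
    simp only [Pi.zero_apply]
    apply mul_nonneg (sq_nonneg a)
    apply div_nonneg _ (by norm_num)
    apply mul_nonneg (by positivity)
    exact mul_nonneg (pow_nonneg h1 9) (by positivity)

end BlochShell

end ZhangJiangXie2025

/-! ## 6. Disintegration over the marginal (Prop. 6.6) and the assembly

The inverse chart `(x, d) ↦ y = ![x 0, x 1, x 2, x 3, d 0 - x 0, d 1 - x 2, d 2 - x 3, x 4, …, x 11]`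
(fibre coordinates `x ∈ ℝ¹²`, marginal coordinates `d ∈ ℝ³`) is the one of
`TwoQubitSeparabilityVolumesProofs.lean` (`HuongKhoi2024.measurePreserving_fibreChart`,
`HuongKhoi2024.twoQubitMatrix_blocks`), written out in full (no notation). -/

namespace ZhangJiangXie2025.BlochShell

open HuongKhoi2024

/-- On the product chart the entry chart IS the general-marginal chart:
`Rmat (d 0) (d 1 + d 2 i) x = twoQubitMatrix y`, `y` the inverse chart of `(x, d)` (blocks `X`, `Z`,
`Z*`, `M − X`). [folklore] -/
theorem Rmat_eq_twoQubitMatrix (x : Fin 12 → ℝ) (d : Fin 3 → ℝ) :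
    Rmat (d 0) ⟨d 1, d 2⟩ x =
      twoQubitMatrix (![x 0, x 1, x 2, x 3, d 0 - x 0, d 1 - x 2, d 2 - x 3, x 4, x 5,
        x 6, x 7, x 8, x 9, x 10, x 11] : Fin 15 → ℝ) := by
  have hM : Mm (d 0) ⟨d 1, d 2⟩ =
      !![((d 0 : ℝ) : ℂ), (⟨d 1, d 2⟩ : ℂ); (⟨d 1, -(d 2)⟩ : ℂ), ((1 - d 0 : ℝ) : ℂ)] := by
    ext i j
    fin_cases i <;> fin_cases j <;> simp [Mm, Complex.ext_iff]
  rw [twoQubitMatrix_blocks, Rmat, hM]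
  rfl

/-- **Prop. 6.6 for the body `D = {ρ ≽ 0}`** (disintegration of the chart volume over the marginal):
`vol₁₅ {ρ ≽ 0, |r|² ≤ t²} = ∫_{B_t} vol₁₂(D^{|r(d)|}) dd`, `B_t = {(2d₀−1)² + 4d₁² + 4d₂² ≤ t²}` the
Bloch ball in the marginal coordinates (the one-sided fibre volume is a function of the Bloch length
only, Prop. 6.5). [cite: ZhangJiangXie2025, Prop 6.6] -/
theorem volume_shell_eq_lintegral (t : ℝ) :
    volume {y : Fin 15 → ℝ | (twoQubitMatrix y).PosSemidef ∧ blochNormSq y ≤ t ^ 2} =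
      ∫⁻ d in {d : Fin 3 → ℝ | (2 * d 0 - 1) ^ 2 + 4 * d 1 ^ 2 + 4 * d 2 ^ 2 ≤ t ^ 2},
        volume {x : Fin 12 → ℝ |
          (qubitBlochFibreMatrix (blochLen (d 0) ⟨d 1, d 2⟩) x).PosSemidef} := by
  classical
  have hΦ := measurePreserving_fibreChart
  set Φ := (fun y : Fin 15 → ℝ =>
      ((![y 0, y 1, y 2, y 3, y 7, y 8, y 9, y 10, y 11, y 12, y 13, y 14] : Fin 12 → ℝ),
        (![y 0 + y 4, y 2 + y 5, y 3 + y 6] : Fin 3 → ℝ))) with hΦdef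
  have hΦΨ : ∀ y : Fin 15 → ℝ,
      (![(Φ y).1 0, (Φ y).1 1, (Φ y).1 2, (Φ y).1 3, (Φ y).2 0 - (Φ y).1 0, (Φ y).2 1 - (Φ y).1 2,
        (Φ y).2 2 - (Φ y).1 3, (Φ y).1 4, (Φ y).1 5, (Φ y).1 6, (Φ y).1 7, (Φ y).1 8, (Φ y).1 9,
        (Φ y).1 10, (Φ y).1 11] : Fin 15 → ℝ) = y := by
    intro y
    ext i
    fin_cases i <;> simp [hΦdef]
  set B : Set (Fin 3 → ℝ) := {d | (2 * d 0 - 1) ^ 2 + 4 * d 1 ^ 2 + 4 * d 2 ^ 2 ≤ t ^ 2} with hB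
  have hBmeas : MeasurableSet B := (isClosed_le (by fun_prop) continuous_const).measurableSet
  set S := {p : (Fin 12 → ℝ) × (Fin 3 → ℝ) |
      (twoQubitMatrix (![p.1 0, p.1 1, p.1 2, p.1 3, p.2 0 - p.1 0, p.2 1 - p.1 2, p.2 2 - p.1 3,
        p.1 4, p.1 5, p.1 6, p.1 7, p.1 8, p.1 9, p.1 10, p.1 11] : Fin 15 → ℝ)).PosSemidef ∧
      p.2 ∈ B} with hS
  have hSmeas : MeasurableSet S :=
    (((isClosed_setOf_posSemidef (Fin 4)).preimage
      (continuous_twoQubitMatrix.comp continuous_fibreChart)).measurableSet).inter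
      (hBmeas.preimage measurable_snd)
  have h1 : {y : Fin 15 → ℝ | (twoQubitMatrix y).PosSemidef ∧ blochNormSq y ≤ t ^ 2} = Φ ⁻¹' S := by
    ext y
    simp only [hS, mem_setOf_eq, mem_preimage, hΦΨ, hB]
    simp [hΦdef, blochNormSq]
  rw [h1, hΦ.measure_preimage hSmeas.nullMeasurableSet, Measure.volume_eq_prod,
    Measure.prod_apply_symm hSmeas]
  have hsec : ∀ d : Fin 3 → ℝ, volume ((fun x : Fin 12 → ℝ => (x, d)) ⁻¹' S) =
      B.indicator (fun d => volume {x : Fin 12 → ℝ |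
        (qubitBlochFibreMatrix (blochLen (d 0) ⟨d 1, d 2⟩) x).PosSemidef}) d := by
    intro d
    by_cases hd : d ∈ B
    · rw [indicator_of_mem hd, ← volume_posSemidef_Rmat_eq]
      congr 1
      ext x
      simp only [hS, mem_preimage, mem_setOf_eq, Rmat_eq_twoQubitMatrix]
      exact ⟨fun h => h.1, fun h => ⟨h, hd⟩⟩
    · rw [indicator_of_notMem hd]
      have : (fun x : Fin 12 → ℝ => (x, d)) ⁻¹' S = ∅ := by
        ext x
        simp only [hS, mem_preimage, mem_setOf_eq, mem_empty_iff_false, iff_false, not_and]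
        exact fun _ => hd
      rw [this, measure_empty]
  simp_rw [hsec]
  exact lintegral_indicator hBmeas _

/-- **Prop. 6.6 for the body `D ∩ D_ss = {0 ≼ ρ ≼ ½}`** (the first display of the proof of
Prop. 6.10, `vol_HS(D^{B_t} ∩ D_ss) = (π/2)∫₀ᵗ a² f(a) da`, before the radial integration):
`vol₁₅ {0 ≼ ρ ≼ ½, |r|² ≤ t²} = ∫_{B_t} F(|r(d)|) dd`, `F = Fvol` the two-sided fibre volume.
[cite: ZhangJiangXie2025, Prop 6.10 (proof, first display)] -/
theorem volume_shell_ss_eq_lintegral (t : ℝ) :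
    volume {y : Fin 15 → ℝ | (twoQubitMatrix y).PosSemidef ∧
        ((2 : ℂ)⁻¹ • (1 : Matrix (Fin 4) (Fin 4) ℂ) - twoQubitMatrix y).PosSemidef ∧
        blochNormSq y ≤ t ^ 2} =
      ∫⁻ d in {d : Fin 3 → ℝ | (2 * d 0 - 1) ^ 2 + 4 * d 1 ^ 2 + 4 * d 2 ^ 2 ≤ t ^ 2},
        Fvol (blochLen (d 0) ⟨d 1, d 2⟩) := by
  classical
  have hΦ := measurePreserving_fibreChart
  set Φ := (fun y : Fin 15 → ℝ =>
      ((![y 0, y 1, y 2, y 3, y 7, y 8, y 9, y 10, y 11, y 12, y 13, y 14] : Fin 12 → ℝ),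
        (![y 0 + y 4, y 2 + y 5, y 3 + y 6] : Fin 3 → ℝ))) with hΦdef
  have hΦΨ : ∀ y : Fin 15 → ℝ,
      (![(Φ y).1 0, (Φ y).1 1, (Φ y).1 2, (Φ y).1 3, (Φ y).2 0 - (Φ y).1 0, (Φ y).2 1 - (Φ y).1 2,
        (Φ y).2 2 - (Φ y).1 3, (Φ y).1 4, (Φ y).1 5, (Φ y).1 6, (Φ y).1 7, (Φ y).1 8, (Φ y).1 9,
        (Φ y).1 10, (Φ y).1 11] : Fin 15 → ℝ) = y := by
    intro y
    ext i
    fin_cases i <;> simp [hΦdef]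
  set B : Set (Fin 3 → ℝ) := {d | (2 * d 0 - 1) ^ 2 + 4 * d 1 ^ 2 + 4 * d 2 ^ 2 ≤ t ^ 2} with hB
  have hBmeas : MeasurableSet B := (isClosed_le (by fun_prop) continuous_const).measurableSet
  set S := {p : (Fin 12 → ℝ) × (Fin 3 → ℝ) |
      (twoQubitMatrix (![p.1 0, p.1 1, p.1 2, p.1 3, p.2 0 - p.1 0, p.2 1 - p.1 2, p.2 2 - p.1 3,
        p.1 4, p.1 5, p.1 6, p.1 7, p.1 8, p.1 9, p.1 10, p.1 11] : Fin 15 → ℝ)).PosSemidef ∧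
      ((2 : ℂ)⁻¹ • (1 : Matrix (Fin 4) (Fin 4) ℂ) -
        twoQubitMatrix (![p.1 0, p.1 1, p.1 2, p.1 3, p.2 0 - p.1 0, p.2 1 - p.1 2, p.2 2 - p.1 3,
          p.1 4, p.1 5, p.1 6, p.1 7, p.1 8, p.1 9, p.1 10, p.1 11] : Fin 15 → ℝ)).PosSemidef ∧
      p.2 ∈ B} with hS
  have hSmeas : MeasurableSet S :=
    (((isClosed_setOf_posSemidef (Fin 4)).preimage
      (continuous_twoQubitMatrix.comp continuous_fibreChart)).measurableSet).inter
      ((((isClosed_setOf_posSemidef (Fin 4)).preimage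
        (continuous_const.sub
          (continuous_twoQubitMatrix.comp continuous_fibreChart))).measurableSet).inter
        (hBmeas.preimage measurable_snd))
  have h1 : {y : Fin 15 → ℝ | (twoQubitMatrix y).PosSemidef ∧
      ((2 : ℂ)⁻¹ • (1 : Matrix (Fin 4) (Fin 4) ℂ) - twoQubitMatrix y).PosSemidef ∧
      blochNormSq y ≤ t ^ 2} = Φ ⁻¹' S := by
    ext y
    simp only [hS, mem_setOf_eq, mem_preimage, hΦΨ, hB]
    simp [hΦdef, blochNormSq]
  rw [h1, hΦ.measure_preimage hSmeas.nullMeasurableSet, Measure.volume_eq_prod,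
    Measure.prod_apply_symm hSmeas]
  have hsec : ∀ d : Fin 3 → ℝ, volume ((fun x : Fin 12 → ℝ => (x, d)) ⁻¹' S) =
      B.indicator (fun d => Fvol (blochLen (d 0) ⟨d 1, d 2⟩)) d := by
    intro d
    by_cases hd : d ∈ B
    · rw [indicator_of_mem hd, ← Ftilde_eq_Fvol, Ftilde]
      congr 1
      ext x
      simp only [hS, mem_preimage, mem_setOf_eq, Rmat_eq_twoQubitMatrix]
      exact ⟨fun h => ⟨h.1, h.2.1⟩, fun h => ⟨h.1, h.2, hd⟩⟩
    · rw [indicator_of_notMem hd]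
      have : (fun x : Fin 12 → ℝ => (x, d)) ⁻¹' S = ∅ := by
        ext x
        simp only [hS, mem_preimage, mem_setOf_eq, mem_empty_iff_false, iff_false, not_and]
        exact fun _ _ => hd
      rw [this, measure_empty]
  simp_rw [hsec]
  exact lintegral_indicator hBmeas _

end ZhangJiangXie2025.BlochShell

open ZhangJiangXie2025 ZhangJiangXie2025.BlochShell in
/-- **Zhang–Jiang–Xie 2025, Props. 6.5, 6.6, 6.7 ⟹ the Bloch-shell form of Prop. 6.10.** The named
fact `ZhangJiangXie2025_blochShell_volume_ratio` (`33·J(t)·vol₁₅(D ∩ D_ss ∩ shell_t) =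
I(t)·vol₁₅(D ∩ shell_t)`, `0 < t ≤ 1/3`) follows from the Bloch-fibre ratio
`ZhangJiangXie2025_qubit_blochFibre_lambdaMax_ratio` (Prop. 6.10 with Prop. 6.7 on each fibre `D^a`,
`a ∈ [0, 1/3)`): disintegrate both chart volumes over the marginal (Prop. 6.6,
`volume_shell_eq_lintegral`, `volume_shell_ss_eq_lintegral`), reduce the fibre volumes to functions
of the Bloch length (Prop. 6.5, `volume_posSemidef_Rmat_eq`, `Ftilde_eq_Fvol`), pass to polar coordinates
(`lintegral_blochBall_radial`, the factor `(π/2)a²`), insert Prop. 6.7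
(`vol(D^a) = (1−a²)⁶ vol(D⁰)`, tree) and the fibre fact, and integrate the two polynomials
(`J = blochShellJ`, `I = blochShellI`); the constants `π/2`, `vol(D⁰) = π⁵/1238630400` and `33`
cancel (`40874803200 = 33 · 1238630400`). With `ZhangJiangXie2025_qubit_blochFibre_lambdaMax_ratio_holds`
this is the discharge `ZhangJiangXie2025_blochShell_volume_ratio_holds`.
[cite: ZhangJiangXie2025, Props 6.5, 6.6, 6.7 (p. 14) and Prop 6.10 (proof, p. 16)] -/
theorem ZhangJiangXie2025_blochShell_volume_ratio_of_fibre_ratio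
    (hX : ZhangJiangXie2025_qubit_blochFibre_lambdaMax_ratio) :
    ZhangJiangXie2025_blochShell_volume_ratio := by
  intro t ht0 ht1
  have ht1' : t < 1 := by linarith
  have e3 : ∫⁻ d in {d : Fin 3 → ℝ | (2 * d 0 - 1) ^ 2 + 4 * d 1 ^ 2 + 4 * d 2 ^ 2 ≤ t ^ 2},
        Fvol (blochLen (d 0) ⟨d 1, d 2⟩) =
      ENNReal.ofReal (π / 2) * ∫⁻ a in Ioo 0 t, ENNReal.ofReal (a ^ 2) * Fvol a :=
    lintegral_blochBall_radial measurable_Fvol ht0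
  have e4 : ∫⁻ d in {d : Fin 3 → ℝ | (2 * d 0 - 1) ^ 2 + 4 * d 1 ^ 2 + 4 * d 2 ^ 2 ≤ t ^ 2},
        volume {x : Fin 12 → ℝ | (qubitBlochFibreMatrix (blochLen (d 0) ⟨d 1, d 2⟩) x).PosSemidef} =
      ENNReal.ofReal (π / 2) * ∫⁻ a in Ioo 0 t, ENNReal.ofReal (a ^ 2) *
        volume {x : Fin 12 → ℝ | (qubitBlochFibreMatrix a x).PosSemidef} :=
    lintegral_blochBall_radial measurable_volume_posSemidef_blochFibre ht0
  rw [volume_shell_ss_eq_lintegral, volume_shell_eq_lintegral, e3, e4,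
    lintegral_sq_mul_Fvol hX ht0 ht1, lintegral_sq_mul_volume_posSemidef ht0 ht1',
    ENNReal.ofReal_mul (by positivity : (0 : ℝ) ≤ π ^ 5 / 40874803200),
    show π ^ 5 / 1238630400 * blochShellJ t = π ^ 5 / 40874803200 * (33 * blochShellJ t) by ring,
    ENNReal.ofReal_mul (by positivity : (0 : ℝ) ≤ π ^ 5 / 40874803200)]
  ring

end Literature.Probability.RandomMatrix

end
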